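import Literature.AlgebraicGeometry.Resolution.KollarSplitBoundary
import Literature.AlgebraicGeometry.Resolution.MarkedIdealsEtale
import Mathlib.AlgebraicGeometry.Morphisms.UniversallyOpen
import HarnessLib

/-!
# The componentwise nonmonomial part commutes with flat pull-backs of triples (Kollár 2007, 3.110–3.111 with 3.34)

Topic: `Literature/AlgebraicGeometry/Resolution`. Shared infrastructure for the decomposition of
the named fact `Kollar2007Thm3_107` (`KollarBlowupSequenceFunctors.lean`; J. Kollár, *Lectures on
Resolution of Singularities*, Ann. of Math. Stud. 166 (2007), 3.110–3.111 and 3.34, pp. 131,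
176–178 of the held copy). Step 1 of 3.111 applies the order-reduction functor of Thm. 3.68 to
the triple `(X, N(I), E)` and asserts that "The functoriality conditions are just as obvious as
before"; for this the nonmonomial part must COMMUTE WITH THE PULL-BACKS OF 3.34.1 (smooth
morphisms) AND 3.34.2 (changes of fields) — which is exactly what fails for Kollár's
per-listed-divisor `N(I)` and holds for the componentwise one (`Kollar2007.Triple.nmPart`,
`KollarSplitBoundary.lean`; cf. the erratum in the module docstring of
`KollarBlowupSequenceFunctors.lean`). This file PROVES it, for a flat morphism `h : X' → X`
between the schemes of two triples with `I' = h^*I` and `E' = h^{-1}(E)` (both 3.34.1 and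
3.34.2 are of this form):

* `stalkIdeal_monomialIdeal_pieces_of_not_mem`, `stalkIdeal_monomialIdeal_pieces_of_mem` —
  stalks of a product `Π_Z 𝓘_Z^{e(Z)}` over the pieces of a divisor `K`: `𝒪_{X,x}` off `V(K)`,
  `K_x^{e(Z_x)}` at a point of the piece `Z_x`;
* `exists_piece_image_subset`, **`closure_image_piece_eq`** — for a flat `h`, a piece (irreducible
  component) `W` of `h^{-1}V(K)` maps into a unique piece `Z` of `V(K)`, and `h(W)` is DENSE in
  `Z` (generizations lift along flat morphisms, `AlgebraicGeometry.Flat.generalizingMap`, so the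
  generic point of `W` maps to the generic point of `Z`);
* `Kollar2007.pieceBelow h Q := 𝓘(cl h(V(Q)))` — the piece of `V(K)` under a piece of
  `h^{-1}V(K)`, `pieceBelow_vanishingIdeal`;
* **`Kollar2007.Triple.mPart_comap_of_flat`, `Kollar2007.Triple.nmPart_comap_of_flat`** —
  **`M(h^*I) = h^*M(I)` and `N(h^*I) = h^*N(I)`** for triples `T`, `T'` and a flat `h` with
  `I' = h^*I`, `E' = h^{-1}(E)`: `h^*M(I)` is the monomial `Π_W 𝓘_W^{c(Z(W))}` over the pieces `W`
  of the `h^{-1}(E^i)` (stalkwise comparison), `h^*N(I) ⊄ 𝓘_W` (else, `h(W)` being dense in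
  `Z(W)`, `N(I) ⊆ 𝓘_{Z(W)}`), and the factorisation `h^*I = h^*M(I) · h^*N(I)` is then the unique
  one of Def.–Lemma 3.110 on `X'` (`eq_nmPart_of_factorization`, `divExp_eq_of_factorization`);
* corollaries `Kollar2007.Triple.IsPullbackAlong.nmPart_eq / mPart_eq` (3.34.1, smooth `h`) and
  `Kollar2007.Triple.IsFieldChange.nmPart_eq / mPart_eq` (3.34.2).

## Sources

* J. Kollár, *Lectures on Resolution of Singularities* (2007), Def.–Lemma 3.110, 3.111 Step 1
  (p. 176), 3.34.1–3.34.2 (p. 131 of the held copy). [Kollar2007]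
* E. Bierstone, D. Grigoriev, P. Milman, J. Włodarczyk, arXiv:1206.3090, §4 Step 2 (p. 12)
  (componentwise monomial part). [BierstoneGrigorievMilmanWlodarczyk2011]
-/

noncomputable section

open CategoryTheory AlgebraicGeometry TopologicalSpace Topology IsLocalRing

namespace Literature.AlgebraicGeometry.Resolution

universe u

variable {X X' : Scheme.{u}}

/-! ## Stalks of a product of powers of piece ideals -/

/-- Off every piece, the stalk of `Π_Z 𝓘_Z^{e(Z)}` is the unit ideal. [folklore] -/
theorem stalkIdeal_monomialIdeal_pieces_of_forall_not_mem (Zs : List (Closeds X))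
    (e : X.IdealSheafData → ℕ) {x : X} (hx : ∀ Z ∈ Zs, x ∉ (Z : Set X)) :
    stalkIdeal (monomialIdeal ((pieceIdeals Zs).map fun P => (P, e P))) x = ⊤ := by
  induction Zs with
  | nil => simp [pieceIdeals, stalkIdeal_top]
  | cons Z rest ih =>
    have hxZ : x ∉ ((Scheme.IdealSheafData.vanishingIdeal Z).support : Set X) := by
      rw [coe_support_vanishingIdeal]; exact hx Z (by simp)
    rw [pieceIdeals, List.map_cons, List.map_cons, monomialIdeal_cons, stalkIdeal_mul, stalkIdeal_pow,
      stalkIdeal_eq_top_of_not_mem_support hxZ, Ideal.top_pow, Ideal.top_mul]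
    exact ih fun Z' hZ' => hx Z' (List.mem_cons_of_mem _ hZ')

/-- Off `V(K)`, the stalk of `Π_Z 𝓘_Z^{e(Z)}` over the pieces of `K` is the unit ideal. [folklore] -/
theorem stalkIdeal_monomialIdeal_pieces_of_not_mem {K : X.IdealSheafData} {Zs : List (Closeds X)}
    (hZs : IsPiecePartition K Zs) (e : X.IdealSheafData → ℕ) {x : X} (hx : x ∉ K.support) :
    stalkIdeal (monomialIdeal ((pieceIdeals Zs).map fun P => (P, e P))) x = ⊤ :=
  stalkIdeal_monomialIdeal_pieces_of_forall_not_mem Zs e fun _ hZ hxZ => hx (hZs.subset hZ hxZ)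

/-- **At a point `x` of the piece `Z` of `V(K)`, the stalk of `Π_{Z'} 𝓘_{Z'}^{e(Z')}` is
`K_x^{e(Z)}`** (the other pieces miss `x`; `(𝓘_Z)_x = K_x`). [folklore] -/
theorem stalkIdeal_monomialIdeal_pieces_of_mem {B : List X.IdealSheafData} {C K : X.IdealSheafData}
    (hB : HasSNCWith B C) (hK : K ∈ B) {Zs : List (Closeds X)} (hZs : IsPiecePartition K Zs)
    (e : X.IdealSheafData → ℕ) {Z : Closeds X} (hZ : Z ∈ Zs) {x : X} (hx : x ∈ (Z : Set X)) :
    stalkIdeal (monomialIdeal ((pieceIdeals Zs).map fun P => (P, e P))) x =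
      stalkIdeal K x ^ e (Scheme.IdealSheafData.vanishingIdeal Z) := by
  -- only the pairwise disjointness and the stalk of the piece through `x` are used
  have hst : stalkIdeal (Scheme.IdealSheafData.vanishingIdeal Z) x = stalkIdeal K x :=
    stalkIdeal_pieceIdeal_eq hB hK hZs hZ hx
  suffices H : ∀ L : List (Closeds X), L.Pairwise (fun Z Z' : Closeds X => Disjoint (Z : Set X) Z') →
      Z ∈ L → stalkIdeal (monomialIdeal ((pieceIdeals L).map fun P => (P, e P))) x =
        stalkIdeal K x ^ e (Scheme.IdealSheafData.vanishingIdeal Z) from H Zs hZs.1 hZ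
  intro L hL hZL
  induction L with
  | nil => simp at hZL
  | cons Z₀ rest ih =>
    rw [List.pairwise_cons] at hL
    rw [pieceIdeals, List.map_cons, List.map_cons, monomialIdeal_cons, stalkIdeal_mul, stalkIdeal_pow]
    rcases List.mem_cons.mp hZL with rfl | hrest
    · -- `x ∈ Z = Z₀`; the other pieces miss `x`
      show stalkIdeal (Scheme.IdealSheafData.vanishingIdeal Z) x ^ e (Scheme.IdealSheafData.vanishingIdeal Z) *
          stalkIdeal (monomialIdeal ((pieceIdeals rest).map fun P => (P, e P))) x = _
      rw [hst, show stalkIdeal (monomialIdeal ((pieceIdeals rest).map fun P => (P, e P))) x = ⊤ from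
        stalkIdeal_monomialIdeal_pieces_of_forall_not_mem rest e fun Z' hZ' hxZ' =>
          Set.disjoint_left.mp (hL.1 Z' hZ') hx hxZ', Ideal.mul_top]
    · -- `Z` further down; `Z₀` misses `x`
      have hxZ₀ : x ∉ ((Scheme.IdealSheafData.vanishingIdeal Z₀).support : Set X) := by
        rw [coe_support_vanishingIdeal]
        exact fun h0 => Set.disjoint_left.mp (hL.1 Z hrest) h0 hx
      rw [stalkIdeal_eq_top_of_not_mem_support hxZ₀, Ideal.top_pow, Ideal.top_mul]
      exact ih hL.2 hrest

/-! ## Pieces under a flat morphism -/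

section Flat

variable (h : X' ⟶ X)

/-- A piece of `h^{-1}V(K)` (indeed any irreducible subset of it) maps into one of the pieces of
`V(K)` (an irreducible set inside a finite union of closed sets lies in one of them).
[folklore] -/
theorem exists_piece_image_subset {K : X.IdealSheafData} {Zs : List (Closeds X)}
    (hZs : IsPiecePartition K Zs) {W : Set X'} (hWirr : IsIrreducible W)
    (hW : W ⊆ (K.comap h).support) : ∃ Z ∈ Zs, h.base '' W ⊆ (Z : Set X) := by
  classical
  have hirr : IsIrreducible (h.base '' W) := hWirr.image _ h.base.hom.continuous.continuousOn
  have hsub : h.base '' W ⊆ ⋃₀ ↑((Zs.map fun Z : Closeds X => (Z : Set X)).toFinset) := by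
    rintro _ ⟨q, hq, rfl⟩
    have hq' : h.base q ∈ K.support := by
      have := hW hq
      rw [Scheme.IdealSheafData.support_comap] at this
      exact this
    obtain ⟨Z, hZ, hqZ⟩ := hZs.exists_mem hq'
    exact Set.mem_sUnion.mpr
      ⟨Z, Finset.mem_coe.mpr (List.mem_toFinset.mpr (List.mem_map.mpr ⟨Z, hZ, rfl⟩)), hqZ⟩
  obtain ⟨z, hz, hWz⟩ := (isIrreducible_iff_sUnion_isClosed.mp hirr) _ (fun z hz => by
    obtain ⟨Z, -, rfl⟩ := List.mem_map.mp (List.mem_toFinset.mp hz)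
    exact Z.isClosed) hsub
  obtain ⟨Z, hZ, rfl⟩ := List.mem_map.mp (List.mem_toFinset.mp hz)
  exact ⟨Z, hZ, hWz⟩

/-- **Under a flat morphism, a piece of `h^{-1}V(K)` is dense over its piece of `V(K)`**: if
`W` is a piece (closed, irreducible) of a partition of `h^{-1}V(K) = V(h^*K)` into closed pieces
and `h(W) ⊆ Z` for an irreducible piece `Z` of `V(K)`, then `cl h(W) = Z`. Indeed the generic
point `ξ` of `Z` generises `h(η)`, `η` the generic point of `W`; generizations lift along the flat
`h` to some `η' ⤳ η` with `h(η') = ξ`; `η'` lies in a piece of `h^{-1}V(K)` containing `η`, i.e. in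
`W`, so `ξ ∈ h(W)`. [cite: Kollar2007, 3.34 (p. 131)] -/
theorem closure_image_piece_eq [Flat h] {K : X.IdealSheafData} {Zs : List (Closeds X)}
    {Ws : List (Closeds X')} (hWs : IsPiecePartition (K.comap h) Ws) {W : Closeds X'}
    (hW : W ∈ Ws) (hWirr : IsIrreducible (W : Set X')) {Z : Closeds X} (hZs : IsPiecePartition K Zs)
    (hZ : Z ∈ Zs) (hZirr : IsIrreducible (Z : Set X)) (hWZ : h.base '' W ⊆ Z) :
    closure (h.base '' (W : Set X')) = Z := by
  refine Set.Subset.antisymm (closure_minimal hWZ Z.isClosed) ?_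
  -- generic points
  have hη := hWirr.isGenericPoint_genericPoint W.isClosed
  have hξ := hZirr.isGenericPoint_genericPoint Z.isClosed
  set η := hWirr.genericPoint
  set ξ := hZirr.genericPoint
  have hηW : η ∈ (W : Set X') := hη.mem
  have hsp : ξ ⤳ h.base η := hξ.specializes (hWZ ⟨η, hηW, rfl⟩)
  obtain ⟨η', hη'η, hη'ξ⟩ := Flat.generalizingMap h hsp
  -- `η'` lies over `V(K)`, hence in a piece, which contains `η` and so is `W`
  have hη'K : η' ∈ (K.comap h).support := by
    rw [Scheme.IdealSheafData.support_comap]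
    show h.base η' ∈ K.support
    rw [hη'ξ]
    exact hZs.subset hZ hξ.mem
  obtain ⟨W', hW', hη'W'⟩ := hWs.exists_mem hη'K
  have hηW' : η ∈ (W' : Set X') := hη'η.mem_closed W'.isClosed hη'W'
  have hWW' : W' = W := hWs.eq_of_mem hW' hW hηW' hηW
  subst hWW'
  -- so `ξ = h η' ∈ h(W)` and `Z = cl{ξ} ⊆ cl h(W)`
  rw [← hξ.def]
  exact closure_mono (Set.singleton_subset_iff.mpr ⟨η', hη'W', hη'ξ⟩)

end Flat

namespace Kollar2007

/-! ## The piece below a piece -/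

/-- **The piece of `V(K)` below a piece of `h^{-1}V(K)`**, as an ideal sheaf: the ideal of the
closure of the image of `V(Q)` (for `Q = 𝓘_W`, `W` a piece of `h^{-1}(E^i)` and `h` flat, this is
`𝓘_Z` for the piece `Z ⊇ h(W)` of `E^i`, `pieceBelow_vanishingIdeal`). [folklore] -/
def pieceBelow (h : X' ⟶ X) (Q : X'.IdealSheafData) : X.IdealSheafData :=
  Scheme.IdealSheafData.vanishingIdeal ⟨closure (h.base '' (Q.support : Set X')), isClosed_closure⟩

/-- For a piece `W` of `h^{-1}V(K)` over the piece `Z` of `V(K)`: `pieceBelow h 𝓘_W = 𝓘_Z`.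
[folklore] -/
theorem pieceBelow_vanishingIdeal (h : X' ⟶ X) [Flat h] {K : X.IdealSheafData}
    {Zs : List (Closeds X)} {Ws : List (Closeds X')} (hWs : IsPiecePartition (K.comap h) Ws)
    {W : Closeds X'} (hW : W ∈ Ws) (hWirr : IsIrreducible (W : Set X')) {Z : Closeds X}
    (hZs : IsPiecePartition K Zs) (hZ : Z ∈ Zs) (hZirr : IsIrreducible (Z : Set X))
    (hWZ : h.base '' W ⊆ Z) :
    pieceBelow h (Scheme.IdealSheafData.vanishingIdeal W) = Scheme.IdealSheafData.vanishingIdeal Z := by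
  rw [pieceBelow]
  congr 1
  ext1
  show closure (h.base '' ((Scheme.IdealSheafData.vanishingIdeal W).support : Set X')) = Z
  rw [coe_support_vanishingIdeal]
  exact closure_image_piece_eq h hWs hW hWirr hZs hZ hZirr hWZ

/-! ## `M` and `N` under flat pull-backs of triples -/

namespace Triple

variable {k k' : Type u} [Field k] [Field k'] {n n' : ℕ} {T : Triple k n} {T' : Triple k' n'}
  {h : T'.X ⟶ T.X}

/-- The pieces of the divisors of a triple are irreducible. [folklore] -/
theorem isIrreducible_of_mem_boundaryPieces {Y : Scheme.{u}} [NoetherianSpace Y]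
    {K : Y.IdealSheafData} {Z : Closeds Y} (hZ : Z ∈ boundaryPieces K) : IsIrreducible (Z : Set Y) :=
  componentsIn.isIrreducible (mem_boundaryPieces_iff.mp hZ)

section Core

variable (hE : T'.boundary = T.boundary.map fun D => D.comap h)
include hE

/-- A divisor of `T` pulls back to a divisor of `T'`. [folklore] -/
theorem comap_mem_boundary_of_mem {K : T.X.IdealSheafData} (hK : K ∈ T.boundary) :
    K.comap h ∈ T'.boundary := by
  rw [hE]
  exact List.mem_map.mpr ⟨K, hK, rfl⟩

/-- For a piece `W` of `h^*K`, `K ∈ E`, `h` flat: the piece of `K` below it, with `h(W) ⊆ Z` and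
`pieceBelow h 𝓘_W = 𝓘_Z`. [folklore] -/
theorem exists_pieceBelow [Flat h] {K : T.X.IdealSheafData} (hK : K ∈ T.boundary)
    {W : Closeds T'.X} (hW : W ∈ boundaryPieces (K.comap h)) :
    ∃ Z ∈ boundaryPieces K, h.base '' W ⊆ (Z : Set T.X) ∧
      pieceBelow h (Scheme.IdealSheafData.vanishingIdeal W) = Scheme.IdealSheafData.vanishingIdeal Z := by
  have hZs := T.isPiecePartition_boundaryPieces_of_mem hK
  have hWs := T'.isPiecePartition_boundaryPieces_of_mem (comap_mem_boundary_of_mem hE hK)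
  have hWirr := isIrreducible_of_mem_boundaryPieces hW
  have hWsub : (W : Set T'.X) ⊆ (K.comap h).support := hWs.subset hW
  obtain ⟨Z, hZ, hWZ⟩ := exists_piece_image_subset h hZs hWirr hWsub
  exact ⟨Z, hZ, hWZ, pieceBelow_vanishingIdeal h hWs hW hWirr hZs hZ
    (isIrreducible_of_mem_boundaryPieces hZ) hWZ⟩

/-- **`h^*(Π_Z 𝓘_Z^{c(𝓘_Z)}) = Π_W 𝓘_W^{c(pieceBelow 𝓘_W)}`** over the pieces of one divisor `K`
and of `h^*K` (stalkwise: at `q` over `x ∈ V(K)` both are `(h^*K)_q^{c(𝓘_{Z_x})}`, the piece of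
`K` through `x` being the piece below the piece of `h^*K` through `q`). [folklore] -/
theorem monomialIdeal_pieces_comap [Flat h] (c : T.X.IdealSheafData → ℕ) {K : T.X.IdealSheafData}
    (hK : K ∈ T.boundary) :
    (monomialIdeal ((pieceIdeals (boundaryPieces K)).map fun P => (P, c P))).comap h =
      monomialIdeal ((pieceIdeals (boundaryPieces (K.comap h))).map fun Q => (Q, c (pieceBelow h Q))) := by
  have hZs := T.isPiecePartition_boundaryPieces_of_mem hK
  have hK' := comap_mem_boundary_of_mem hE hK
  have hWs := T'.isPiecePartition_boundaryPieces_of_mem hK'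
  refine ext_of_forall_stalkIdeal_eq fun q => ?_
  rw [stalkIdeal_comap_eq_map]
  by_cases hq : h.base q ∈ K.support
  · -- over `V(K)`: the pieces through `h q` and through `q`
    obtain ⟨Z, hZ, hqZ⟩ := hZs.exists_mem hq
    have hq' : q ∈ (K.comap h).support := by
      rw [Scheme.IdealSheafData.support_comap]; exact hq
    obtain ⟨W, hW, hqW⟩ := hWs.exists_mem hq'
    obtain ⟨Z₁, hZ₁, hWZ₁, hbelow⟩ := exists_pieceBelow hE hK hW
    have hZZ₁ : Z₁ = Z := hZs.eq_of_mem hZ₁ hZ (hWZ₁ ⟨q, hqW, rfl⟩) hqZ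
    subst hZZ₁
    rw [stalkIdeal_monomialIdeal_pieces_of_mem T.hasSNC hK hZs c hZ hqZ,
      stalkIdeal_monomialIdeal_pieces_of_mem T'.hasSNC hK' hWs (fun Q => c (pieceBelow h Q)) hW hqW,
      Ideal.map_pow, ← stalkIdeal_comap_eq_map, hbelow]
  · -- off `V(K)`: both unit ideals
    have hq' : q ∉ (K.comap h).support := by
      rw [Scheme.IdealSheafData.support_comap]; exact hq
    rw [stalkIdeal_monomialIdeal_pieces_of_not_mem hZs c hq,
      stalkIdeal_monomialIdeal_pieces_of_not_mem hWs _ hq', Ideal.map_top]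

/-- The same over all divisors: **`h^*M = Π_{Q ∈ split E'} Q^{c(pieceBelow Q)}`** for the monomial
`M = Π_{P ∈ split E} P^{c(P)}`. [folklore] -/
theorem monomialIdeal_splitBoundary_comap [Flat h] (c : T.X.IdealSheafData → ℕ) :
    (monomialIdeal (T.splitBoundary.map fun P => (P, c P))).comap h =
      monomialIdeal (T'.splitBoundary.map fun Q => (Q, c (pieceBelow h Q))) := by
  rw [Triple.splitBoundary, Triple.splitBoundary, hE]
  suffices H : ∀ L : List T.X.IdealSheafData, (∀ K ∈ L, K ∈ T.boundary) →
      (monomialIdeal ((L.flatMap fun K => pieceIdeals (boundaryPieces K)).map fun P => (P, c P))).comap h =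
        monomialIdeal (((L.map fun D => D.comap h).flatMap fun K =>
          pieceIdeals (boundaryPieces K)).map fun Q => (Q, c (pieceBelow h Q))) from
    H T.boundary fun _ hK => hK
  intro L hL
  induction L with
  | nil => simp [monomialIdeal_nil, Scheme.IdealSheafData.comap_top]
  | cons K rest ih =>
    rw [List.flatMap_cons, List.map_cons, List.flatMap_cons, List.map_append, List.map_append,
      monomialIdeal_append, monomialIdeal_append, comap_mul,
      monomialIdeal_pieces_comap hE c (hL K (by simp)), ih fun K' hK' => hL K' (by simp [hK'])]

/-- **`h^*N(I)` is contained in no piece of `E'`** (`h` flat): if `h^*N ⊆ 𝓘_W` for a piece `W`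
of `h^*K` then `h(W) ⊆ cosupp N`, hence its closure, the piece `Z` of `K` below `W`, lies in
`cosupp N`, i.e. `N ⊆ 𝓘_Z` — against Def.–Lemma 3.110 for `N = N(I)`.
[cite: Kollar2007, Def.–Lemma 3.110 (p. 176)] -/
theorem not_nmPart_comap_le [Flat h] {Q : T'.X.IdealSheafData} (hQ : Q ∈ T'.splitBoundary) :
    ¬ T.nmPart.comap h ≤ Q := by
  intro hle
  obtain ⟨K', hK', W, hW, rfl⟩ := T'.mem_splitBoundary_iff.mp hQ
  -- `K' = h^*K`
  have hK'' : K' ∈ T.boundary.map fun D => D.comap h := hE ▸ hK'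
  obtain ⟨K, hK, rfl⟩ := List.mem_map.mp hK''
  obtain ⟨Z, hZ, hWZ, -⟩ := exists_pieceBelow hE hK hW
  -- `W ⊆ cosupp h^*N = h⁻¹ cosupp N`
  have h1 : (W : Set T'.X) ⊆ (T.nmPart.comap h).support := by
    have := Scheme.IdealSheafData.le_support_iff_le_vanishingIdeal.mpr hle
    intro q hq
    exact this hq
  rw [Scheme.IdealSheafData.support_comap] at h1
  -- `Z = cl h(W) ⊆ cosupp N`
  have h2 : (Z : Set T.X) ⊆ T.nmPart.support := by
    have hcl := closure_image_piece_eq h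
      (T'.isPiecePartition_boundaryPieces_of_mem (comap_mem_boundary_of_mem hE hK)) hW
      (isIrreducible_of_mem_boundaryPieces hW) (T.isPiecePartition_boundaryPieces_of_mem hK) hZ
      (isIrreducible_of_mem_boundaryPieces hZ) hWZ
    rw [← hcl]
    refine closure_minimal ?_ T.nmPart.support.isClosed
    rintro _ ⟨q, hq, rfl⟩
    exact h1 hq
  have h3 : T.nmPart ≤ Scheme.IdealSheafData.vanishingIdeal Z :=
    Scheme.IdealSheafData.le_support_iff_le_vanishingIdeal.mp h2
  exact T.not_nmPart_le_of_mem_splitBoundary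
    (T.mem_splitBoundary_iff.mpr ⟨K, hK, Z, hZ, rfl⟩) h3

variable (hI : T'.ideal = T.ideal.comap h)
include hI

/-- The factorisation `h^*I = (Π_Q Q^{c'(Q)}) · h^*N(I)` over the split boundary of `T'`, with
`c'(Q) = c(pieceBelow Q)` the exponents of `M(I)`. [cite: Kollar2007, Def.–Lemma 3.110 (p. 176)] -/
theorem monomialIdeal_mul_nmPart_comap [Flat h] :
    monomialIdeal (T'.splitBoundary.map fun Q => (Q, divExp T.ideal (pieceBelow h Q))) *
        T.nmPart.comap h = T'.ideal := by
  rw [← monomialIdeal_splitBoundary_comap hE (divExp T.ideal)]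
  show T.mPart.comap h * T.nmPart.comap h = T'.ideal
  rw [← comap_mul, T.mPart_mul_nmPart, hI]

/-- **`N(h^*I) = h^*N(I)`**: the componentwise nonmonomial part commutes with flat pull-backs of
triples (`I' = h^*I`, `E' = h^{-1}E`). [cite: Kollar2007, Def.–Lemma 3.110 with 3.34 (pp. 131, 176)] -/
theorem nmPart_eq_comap_of_flat [Flat h] : T'.nmPart = T.nmPart.comap h :=
  (T'.eq_nmPart_of_factorization _ _ (monomialIdeal_mul_nmPart_comap hE hI)
    fun _ hQ => not_nmPart_comap_le hE hQ).symm

/-- **`M(h^*I) = h^*M(I)`**: the componentwise monomial part commutes with flat pull-backs of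
triples (the exponent of a piece `W` of `h^{-1}(E^i)` in `h^*I` is the exponent of the piece of
`E^i` below it in `I`, `divExp_eq_of_factorization`). [cite: Kollar2007, Def.–Lemma 3.110 with 3.34 (pp. 131, 176)] -/
theorem mPart_eq_comap_of_flat [Flat h] : T'.mPart = T.mPart.comap h := by
  haveI := T'.isLocallyNoetherian
  have hexp : ∀ Q ∈ T'.splitBoundary, divExp T.ideal (pieceBelow h Q) = divExp T'.ideal Q :=
    fun Q hQ => divExp_eq_of_factorization T'.hasSNC_splitBoundary T'.splitBoundary_pairwise
      T'.stalkIdeal_ne_bot _ _ (monomialIdeal_mul_nmPart_comap hE hI)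
      (fun Q hQ _ => not_nmPart_comap_le hE hQ) hQ (T'.ne_top_of_mem_splitBoundary hQ)
  have hM : T'.mPart = monomialIdeal (T'.splitBoundary.map fun Q => (Q, divExp T.ideal (pieceBelow h Q))) := by
    rw [Triple.mPart, monomialPart, monomialPartExp]
    congr 1
    exact List.map_congr_left fun Q hQ => by rw [hexp Q hQ]
  rw [hM, ← monomialIdeal_splitBoundary_comap hE]
  rfl

end Core

/-! ## 3.34.1 and 3.34.2 -/

/-- **`N(I)` commutes with the pull-backs of 3.34.1** (smooth, indeed flat, `h` with
`T' = (X', h^*I, h^{-1}E)`). [cite: Kollar2007, 3.34.1 (p. 131) with Def.–Lemma 3.110] -/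
theorem IsPullbackAlong.nmPart_eq {k : Type u} [Field k] {n n' : ℕ} {T : Triple k n}
    {T' : Triple k n'} {h : T'.X ⟶ T.X} [Flat h] (hT : T.IsPullbackAlong T' h) :
    T'.nmPart = T.nmPart.comap h :=
  nmPart_eq_comap_of_flat hT.boundary_eq hT.ideal_eq

/-- `M(I)` commutes with the pull-backs of 3.34.1. [cite: Kollar2007, 3.34.1 (p. 131) with Def.–Lemma 3.110] -/
theorem IsPullbackAlong.mPart_eq {k : Type u} [Field k] {n n' : ℕ} {T : Triple k n}
    {T' : Triple k n'} {h : T'.X ⟶ T.X} [Flat h] (hT : T.IsPullbackAlong T' h) :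
    T'.mPart = T.mPart.comap h :=
  mPart_eq_comap_of_flat hT.boundary_eq hT.ideal_eq

/-- **`N(I)` commutes with changes of fields (3.34.2).**
[cite: Kollar2007, 3.34.2 (p. 131) with Def.–Lemma 3.110] -/
theorem IsFieldChange.nmPart_eq {K L : Type u} [Field K] [Field L] {σ : K →+* L} {n n' : ℕ}
    {T : Triple K n} {T' : Triple L n'} {g : T'.X ⟶ T.X} (hF : IsFieldChange σ T T' g) :
    T'.nmPart = T.nmPart.comap g :=
  haveI : Flat g := MorphismProperty.of_isPullback (P := @Flat) hF.isPullback.flip inferInstance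
  nmPart_eq_comap_of_flat hF.boundary_eq hF.ideal_eq

/-- `M(I)` commutes with changes of fields (3.34.2). [cite: Kollar2007, 3.34.2 (p. 131) with Def.–Lemma 3.110] -/
theorem IsFieldChange.mPart_eq {K L : Type u} [Field K] [Field L] {σ : K →+* L} {n n' : ℕ}
    {T : Triple K n} {T' : Triple L n'} {g : T'.X ⟶ T.X} (hF : IsFieldChange σ T T' g) :
    T'.mPart = T.mPart.comap g :=
  haveI : Flat g := MorphismProperty.of_isPullback (P := @Flat) hF.isPullback.flip inferInstance
  mPart_eq_comap_of_flat hF.boundary_eq hF.ideal_eq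

/-- The triples `(X, N(I), E)` pull back with `T`: if `T'` is the pull-back of `T` along a flat
`k`-morphism `h` then `T'.withNmPart` is the pull-back of `T.withNmPart` along `h` (so the
order-reduction functor of Step 1 can be compared along `h`, 3.34.1).
[cite: Kollar2007, 3.111 Step 1 with 3.34.1 (pp. 131, 176)] -/
theorem IsPullbackAlong.withNmPart {k : Type u} [Field k] {n n' : ℕ} {T : Triple k n}
    {T' : Triple k n'} {h : T'.X ⟶ T.X} [Flat h] (hT : T.IsPullbackAlong T' h) :
    T.withNmPart.IsPullbackAlong T'.withNmPart h where
  comp_struct := hT.comp_struct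
  ideal_eq := hT.nmPart_eq
  boundary_eq := hT.boundary_eq

/-- The triples `(X, N(I), E)` change fields with `T` (3.34.2). [cite: Kollar2007, 3.111 Step 1 with 3.34.2 (pp. 131, 176)] -/
theorem IsFieldChange.withNmPart {K L : Type u} [Field K] [Field L] {σ : K →+* L} {n n' : ℕ}
    {T : Triple K n} {T' : Triple L n'} {g : T'.X ⟶ T.X} (hF : IsFieldChange σ T T' g) :
    IsFieldChange σ T.withNmPart T'.withNmPart g :=
  ⟨hF.isPullback, hF.nmPart_eq, hF.boundary_eq⟩

end Triple

end Kollar2007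

end Literature.AlgebraicGeometry.Resolution

end
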